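import Summits.QuantumFields.YangMills.Theses.ThermodynamicCeilings

/-!
# Route `ThermodynamicCeilings` — normalisation of the pair spectral representation: `κ₀ ≥ 0` (support, step 4b)

D-0145 ideator seat ym-idea-11 (g5).  Step 4b of `rep_plan.md` (evidence on items 27771/27776).  After the pairing identity
(`SpectralPairing.hasSum_pairing`) the centred pair correlation is `c(t) = S(t)/Z − (S₁/Z)²` with `Z = Σ λ_i^N`, the one-insertion
trace `S₁ = Σ_i a_i m_i u_i` and the degenerate part `D = Σ_p d_p ≥ Σ_i a_i m_i²` (`a_i = λ_i^N, u = 1` for slice observables;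
`a_i = λ_i^{N-2}, u_i = λ_i` for bond observables, `Z = Σ a_i u_i²`).  The constant `κ₀ = D/Z − (S₁/Z)²` of clause (i) is `≥ 0` by the
weighted Cauchy–Schwarz inequality `S₁² ≤ (Σ a m²)(Σ a u²)`.  This file: Cauchy–Schwarz for real `tsum`s (`tsum_mul_sq_le`, via Hölder
`p = q = 2`), its weighted form (`weighted_cauchy_schwarz`), the diagonal comparison `Σ_i d(i,i) ≤ Σ_p d_p` (`tsum_diag_le`) and the
bookkeeping `kappa0_nonneg`.  Pure Mathlib; closes nothing; no summit / leaf / NT / UV / IR statement is proved.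
-/

namespace Summit.QuantumFields.YangMills.Cruxes.MirrorMonotoneDecay.SpectralNormalisation

variable {ι : Type*}

/-- **Cauchy–Schwarz for real `tsum`s**: `(Σ f g)² ≤ (Σ f²)(Σ g²)` when `Σ f²`, `Σ g²` converge (and `Σ |f||g|` converges). -/
theorem tsum_mul_sq_le (f g : ι → ℝ) (hf : Summable fun i => f i ^ 2) (hg : Summable fun i => g i ^ 2) :
    (Summable fun i => |f i| * |g i|) ∧ (∑' i, f i * g i) ^ 2 ≤ (∑' i, f i ^ 2) * (∑' i, g i ^ 2) := by
  have hf' : Summable fun i => |f i| ^ (2:ℝ) := by simpa only [Real.rpow_two, sq_abs] using hf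
  have hg' : Summable fun i => |g i| ^ (2:ℝ) := by simpa only [Real.rpow_two, sq_abs] using hg
  obtain ⟨hs, hle⟩ := Real.summable_and_inner_le_Lp_mul_Lq_tsum_of_nonneg Real.HolderConjugate.two_two
    (fun i => abs_nonneg (f i)) (fun i => abs_nonneg (g i)) hf' hg'
  refine ⟨hs, ?_⟩
  have eq1 : (∑' i, |f i| ^ (2:ℝ)) = ∑' i, f i ^ 2 := by simp only [Real.rpow_two, sq_abs]
  have eq2 : (∑' i, |g i| ^ (2:ℝ)) = ∑' i, g i ^ 2 := by simp only [Real.rpow_two, sq_abs]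
  rw [eq1, eq2] at hle
  have hA : 0 ≤ ∑' i, f i ^ 2 := tsum_nonneg fun i => sq_nonneg _
  have hB : 0 ≤ ∑' i, g i ^ 2 := tsum_nonneg fun i => sq_nonneg _
  have h1 : |∑' i, f i * g i| ≤ ∑' i, |f i| * |g i| := by
    have h := norm_tsum_le_tsum_norm (f := fun i => f i * g i) (by simpa only [Real.norm_eq_abs, abs_mul] using hs)
    simpa only [Real.norm_eq_abs, abs_mul] using h
  have h0 : 0 ≤ ∑' i, |f i| * |g i| := tsum_nonneg fun i => mul_nonneg (abs_nonneg _) (abs_nonneg _)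
  have h2 : (∑' i, |f i| * |g i|) ^ 2 ≤ (∑' i, f i ^ 2) * (∑' i, g i ^ 2) := by
    calc (∑' i, |f i| * |g i|) ^ 2 ≤ ((∑' i, f i ^ 2) ^ (1 / 2 : ℝ) * (∑' i, g i ^ 2) ^ (1 / 2 : ℝ)) ^ 2 :=
          pow_le_pow_left₀ h0 hle 2
      _ = (∑' i, f i ^ 2) * (∑' i, g i ^ 2) := by
          rw [mul_pow, ← Real.rpow_two ((∑' i, f i ^ 2) ^ (1 / 2 : ℝ)), ← Real.rpow_two ((∑' i, g i ^ 2) ^ (1 / 2 : ℝ)),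
            ← Real.rpow_mul hA, ← Real.rpow_mul hB]
          norm_num
  calc (∑' i, f i * g i) ^ 2 = |∑' i, f i * g i| ^ 2 := (sq_abs _).symm
    _ ≤ (∑' i, |f i| * |g i|) ^ 2 := pow_le_pow_left₀ (abs_nonneg _) h1 2
    _ ≤ (∑' i, f i ^ 2) * (∑' i, g i ^ 2) := h2

/-- **weighted Cauchy–Schwarz**: for `a ≥ 0`, `(Σ a m u)² ≤ (Σ a m²)(Σ a u²)` when the two right-hand sums converge. -/
theorem weighted_cauchy_schwarz (a m u : ι → ℝ) (ha : ∀ i, 0 ≤ a i) (hm : Summable fun i => a i * m i ^ 2)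
    (hu : Summable fun i => a i * u i ^ 2) :
    (∑' i, a i * m i * u i) ^ 2 ≤ (∑' i, a i * m i ^ 2) * (∑' i, a i * u i ^ 2) := by
  have e1 : (fun i => (Real.sqrt (a i) * m i) ^ 2) = fun i => a i * m i ^ 2 := by
    funext i; rw [mul_pow, Real.sq_sqrt (ha i)]
  have e2 : (fun i => (Real.sqrt (a i) * u i) ^ 2) = fun i => a i * u i ^ 2 := by
    funext i; rw [mul_pow, Real.sq_sqrt (ha i)]
  have e3 : (fun i => Real.sqrt (a i) * m i * (Real.sqrt (a i) * u i)) = fun i => a i * m i * u i := by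
    funext i
    have : Real.sqrt (a i) * Real.sqrt (a i) = a i := Real.mul_self_sqrt (ha i)
    calc Real.sqrt (a i) * m i * (Real.sqrt (a i) * u i) = (Real.sqrt (a i) * Real.sqrt (a i)) * m i * u i := by ring
      _ = a i * m i * u i := by rw [this]
  have h := (tsum_mul_sq_le (fun i => Real.sqrt (a i) * m i) (fun i => Real.sqrt (a i) * u i)
    (by rw [e1]; exact hm) (by rw [e2]; exact hu)).2
  rw [e3, e1, e2] at h
  exact h

/-- the diagonal of a non-negative summable family on `ι × ι` sums to at most the whole family. -/
theorem tsum_diag_le (d : ι × ι → ℝ) (hd0 : ∀ p, 0 ≤ d p) (hsd : Summable d) :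
    ∑' i, d (i, i) ≤ ∑' p, d p :=
  tsum_comp_le_tsum_of_inj hsd hd0 (i := fun i : ι => (i, i)) fun _ _ h => (Prod.mk.inj h).1

/-- **`κ₀ ≥ 0` (bookkeeping).**  If `S₁² ≤ D₀ Z`, `D₀ ≤ D` and `0 < Z` then `0 ≤ D/Z − (S₁/Z)²`. -/
theorem kappa0_nonneg (S₁ D₀ D Z : ℝ) (hZ : 0 < Z) (hcs : S₁ ^ 2 ≤ D₀ * Z) (hD : D₀ ≤ D) :
    0 ≤ D / Z - (S₁ / Z) ^ 2 := by
  rw [div_pow, sub_nonneg, div_le_div_iff₀ (by positivity) hZ]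
  have : D₀ * Z * Z ≤ D * Z * Z := by
    apply mul_le_mul_of_nonneg_right (mul_le_mul_of_nonneg_right hD hZ.le) hZ.le
  nlinarith

/-- **The normalised constant of clause (i), slice and bond cases at once.**  With weights `a ≥ 0`, matrix diagonal `m`,
insertion weight `u`, `Z = Σ a u² > 0`, `S₁ = Σ a m u`, and a degenerate part `D ≥ Σ a m²`: `κ₀ := D/Z − (S₁/Z)² ≥ 0`. -/
theorem kappa0_nonneg_of_sums (a m u : ι → ℝ) (ha : ∀ i, 0 ≤ a i) (hm : Summable fun i => a i * m i ^ 2)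
    (hu : Summable fun i => a i * u i ^ 2) (hZ : 0 < ∑' i, a i * u i ^ 2) (D : ℝ) (hD : ∑' i, a i * m i ^ 2 ≤ D) :
    0 ≤ D / (∑' i, a i * u i ^ 2) - ((∑' i, a i * m i * u i) / ∑' i, a i * u i ^ 2) ^ 2 :=
  kappa0_nonneg _ _ _ _ hZ (weighted_cauchy_schwarz a m u ha hm hu) hD

end Summit.QuantumFields.YangMills.Cruxes.MirrorMonotoneDecay.SpectralNormalisation
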